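import Literature.Analysis.OperatorTheory.PositiveKernelTransferOperator
import Mathlib.MeasureTheory.Integral.MeanInequalities
import Mathlib.Analysis.Convex.Slope
import Mathlib.Analysis.Calculus.Deriv.Slope
import Mathlib.Analysis.SpecialFunctions.Log.Deriv
import Mathlib.Analysis.SpecialFunctions.Pow.NNReal
import Mathlib.Analysis.Calculus.ParametricIntegral
import HarnessLib

/-!
# Kingman's log-convexity of the norm of positive-kernel operators, and the secant bracket for
# Hellmann–Feynman values — PROVED

Topic `Literature/Analysis/OperatorTheory`; companion of `PositiveKernelTransferOperator.lean` (integral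
operators `(Aφ)(x) = ∫ K(x,y) φ(y) dμ(y)` with bounded measurable real kernels on `L²` of a finite measure,
given through the a.e. kernel formula `hA : ∀ φ, A φ =ᵐ[μ] fun x => ∫ y, K x y * φ y ∂μ`). Theorems only
(no definition, no named fact).

## 1. Kingman's theorem (Hadamard weighted geometric means of positive kernel operators)

Kingman (1961) proved that the Perron root of a non-negative matrix whose entries are log-convex
functions of a parameter is a log-convex function of the parameter; Drnovšek–Peperko extended the
underlying inequality to positive kernel operators on Banach function spaces, for the operator norm as
well as for the spectral radius: for positive kernel operators `K₁, …, Kₙ` and positive weights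
`α₁ + ⋯ + αₙ = 1`, the operator with kernel `k₁^{α₁} ⋯ kₙ^{αₙ}` satisfies
`ρ(K₁^{(α₁)} ∘ ⋯ ∘ Kₙ^{(αₙ)}) ≤ ρ(K₁)^{α₁} ⋯ ρ(Kₙ)^{αₙ}` for `ρ ∈ {‖·‖, r}`
[cite: BogdanovicPeperko2022, Thm. 1.1 (i)] [cite: Kingman1961, Theorem]. We prove the OPERATOR-NORM
case `n = 2` on `L²(X, μ)`, `μ` finite, real scalars, in the domination form that is convenient for
parametrised families:

* `inner_kernelOp_le_of_le_rpow_mul_rpow` — if `0 ≤ K ≤ K₀^θ K₁^{1-θ}` pointwise (`K₀, K₁ ≥ 0`,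
  `0 ≤ θ ≤ 1`) then `⟪φ, A ψ⟫ ≤ ‖A₀‖^θ ‖A₁‖^{1-θ} ‖φ‖ ‖ψ‖` for all `φ, ψ ∈ L²` (positivity of the kernel
  reduces to `|φ|, |ψ|`; then Hölder's inequality with exponents `1/θ, 1/(1-θ)` on `X × X`, in Mathlib's
  form `ENNReal.lintegral_mul_norm_pow_le`);
* `norm_kernelOp_le_rpow_mul_rpow` — **`‖A‖ ≤ ‖A₀‖^θ ‖A₁‖^{1-θ}`** (take `φ = Aψ`);
* `norm_kernelOp_convexComb_le`, `convexOn_log_norm_kernelOp` — for a family of non-negative bounded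
  kernels `K t` indexed by a convex set `D` of a real vector space which is POINTWISE LOG-CONVEX,
  `K(θa+(1-θ)b) ≤ K(a)^θ K(b)^{1-θ}`, the norms satisfy the same inequality, and `t ↦ log ‖A t‖` is
  convex on `D` (when no `A t` vanishes) — Kingman's statement for the norm.

## 2. The secant bracket for Hellmann–Feynman values (no differentiability of the norm needed)

For a CONVEX function `f` on `[β-h, β+h]` and a function `g ≤ f` near `β` with `g β = f β` which is
differentiable at `β`, the two secant slopes of `f` bracket `g′(β)`:
`(f β - f(β-h))/h ≤ g′(β) ≤ (f(β+h) - f β)/h` (`secant_le_hasDerivAt_le_secant`: the difference quotients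
of a convex function are monotone [cite: Dudley2002, §6.3 Prop. 6.3.2 and Cor. 6.3.3], and those of `g`
at `β` are squeezed by those of `f` because `g` touches `f` from below). Applied to `f t = log ‖T t‖` for a
family of bounded operators on a real Hilbert space and `g t = log ⟪ψ, T t ψ⟫` for a unit vector `ψ`
with `⟪ψ, T β ψ⟫ = ‖T β‖` (any normalised top eigenvector of a positive operator), this gives
`log_norm_secant_bracket`:

  `(log ‖T β‖ - log ‖T (β-h)‖)/h ≤ g′(β)/‖T β‖ ≤ (log ‖T (β+h)‖ - log ‖T β‖)/h`,

where `g′(β) = d/dt ⟪ψ, T t ψ⟫|_{t=β}` is the Hellmann–Feynman value — valid WITHOUT assuming that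
`t ↦ ‖T t‖` is differentiable at `β` or that the top of the spectrum is simple or isolated. This is the
theorem behind "secant" certificates that enclose a Hellmann–Feynman expectation between two chords
of a certified log-convex top eigenvalue (e.g. for transfer matrices whose kernels `e^{β·(action)}` are
log-convex — indeed log-affine — in the couplings, by §1).

## Mathlib / tree search

Mathlib: `ENNReal.lintegral_mul_norm_pow_le` (two-function Hölder with weights `p + q = 1`),
`ConvexOn.secant_mono`, `HasDerivAt.tendsto_slope_zero_right/left`, `Real.hasDerivAt_log`; no
log-convexity statement for norms or spectral radii of positive operators (`lean search Kingman|logConvex`: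
only `Literature/Analysis/Convex/LogConvexSequenceChord` for sequences, and
`convexOn_log_norm_riemannZeta`). Tree: `PositiveKernelTransferOperator.lean` supplies
`inner_kernelOp_eq_integral`, `integrable_mul_kernel_mul`.

## References

* J. F. C. Kingman, *A convexity property of positive matrices*, Quart. J. Math. Oxford (2) 12 (1961)
  283–284. [Kingman1961]
* K. Bogdanović, A. Peperko, *Hadamard weighted geometric mean inequalities for the spectral and
  essential spectral radius of positive operators on Banach function and sequence spaces*, Positivity 26
  (2022), Thm. 1.1 (i) (= Drnovšek–Peperko, Positivity 10 (2006); Peperko, Positivity 2006), held copy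
  arXiv:2107.09459 p. 4. [BogdanovicPeperko2022]
* R. M. Dudley, *Real Analysis and Probability*, CUP 2002, §6.3, Prop. 6.3.2, Cor. 6.3.3. [Dudley2002]
-/

noncomputable section

open MeasureTheory Set Filter Function Topology
open scoped RealInnerProductSpace ENNReal

namespace Literature.Analysis.OperatorTheory

/-! ## 1. Kingman's inequality for positive-kernel operators on `L²` -/

section Kingman

variable {X : Type*} [MeasurableSpace X] {μ : Measure X} [IsFiniteMeasure μ]

/-- The bilinear form of a kernel operator as an integral over `X × X`:
`⟪φ, Aψ⟫ = ∫ φ(x) K(x,y) ψ(y) d(μ ⊗ μ)`. [folklore] -/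
private theorem inner_kernelOp_eq_integral_prod {K : X → X → ℝ} {C : ℝ}
    (hK : StronglyMeasurable (uncurry K)) (hC : ∀ x y, ‖K x y‖ ≤ C)
    {A : Lp ℝ 2 μ →L[ℝ] Lp ℝ 2 μ}
    (hA : ∀ φ : Lp ℝ 2 μ, (A φ : X → ℝ) =ᵐ[μ] fun x => ∫ y, K x y * φ y ∂μ) (φ ψ : Lp ℝ 2 μ) :
    ⟪φ, A ψ⟫ = ∫ z, φ z.1 * (K z.1 z.2 * ψ z.2) ∂(μ.prod μ) := by
  rw [inner_kernelOp_eq_integral hA, integral_prod _ (integrable_mul_kernel_mul hK hC φ ψ)]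
  refine integral_congr_ae (Eventually.of_forall fun x => ?_)
  exact (integral_const_mul (φ x) _).symm

/-- The absolute-value integrand `|φ(x)| K(x,y) |ψ(y)|` is integrable on `μ ⊗ μ` (it is the absolute
value of the integrable `φ(x) K(x,y) ψ(y)` when `K ≥ 0`). [folklore] -/
private theorem integrable_abs_mul_kernel_mul_abs {K : X → X → ℝ} {C : ℝ}
    (hK : StronglyMeasurable (uncurry K)) (hC : ∀ x y, ‖K x y‖ ≤ C) (hK0 : ∀ x y, 0 ≤ K x y)
    (φ ψ : Lp ℝ 2 μ) :
    Integrable (fun z : X × X => |φ z.1| * (K z.1 z.2 * |ψ z.2|)) (μ.prod μ) := by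
  refine ((integrable_mul_kernel_mul hK hC φ ψ).abs).congr (Eventually.of_forall fun z => ?_)
  change |φ z.1 * (K z.1 z.2 * ψ z.2)| = |φ z.1| * (K z.1 z.2 * |ψ z.2|)
  rw [abs_mul, abs_mul, abs_of_nonneg (hK0 z.1 z.2)]

/-- For a non-negative kernel, `⟪φ, Aψ⟫ ≤ ∫ |φ(x)| K(x,y) |ψ(y)|`. [folklore] -/
private theorem inner_kernelOp_le_integral_abs {K : X → X → ℝ} {C : ℝ}
    (hK : StronglyMeasurable (uncurry K)) (hC : ∀ x y, ‖K x y‖ ≤ C) (hK0 : ∀ x y, 0 ≤ K x y)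
    {A : Lp ℝ 2 μ →L[ℝ] Lp ℝ 2 μ}
    (hA : ∀ φ : Lp ℝ 2 μ, (A φ : X → ℝ) =ᵐ[μ] fun x => ∫ y, K x y * φ y ∂μ) (φ ψ : Lp ℝ 2 μ) :
    ⟪φ, A ψ⟫ ≤ ∫ z, |φ z.1| * (K z.1 z.2 * |ψ z.2|) ∂(μ.prod μ) := by
  rw [inner_kernelOp_eq_integral_prod hK hC hA]
  refine integral_mono (integrable_mul_kernel_mul hK hC φ ψ)
    (integrable_abs_mul_kernel_mul_abs hK hC hK0 φ ψ) fun z => ?_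
  change φ z.1 * (K z.1 z.2 * ψ z.2) ≤ |φ z.1| * (K z.1 z.2 * |ψ z.2|)
  calc φ z.1 * (K z.1 z.2 * ψ z.2) ≤ |φ z.1 * (K z.1 z.2 * ψ z.2)| := le_abs_self _
    _ = |φ z.1| * (K z.1 z.2 * |ψ z.2|) := by rw [abs_mul, abs_mul, abs_of_nonneg (hK0 z.1 z.2)]

/-- For a non-negative kernel, `∫ |φ(x)| K(x,y) |ψ(y)| = ⟪|φ|, A|ψ|⟫ ≤ ‖A‖ ‖φ‖ ‖ψ‖`. [folklore] -/
private theorem integral_abs_le_norm {K : X → X → ℝ} {C : ℝ}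
    (hK : StronglyMeasurable (uncurry K)) (hC : ∀ x y, ‖K x y‖ ≤ C)
    {A : Lp ℝ 2 μ →L[ℝ] Lp ℝ 2 μ}
    (hA : ∀ φ : Lp ℝ 2 μ, (A φ : X → ℝ) =ᵐ[μ] fun x => ∫ y, K x y * φ y ∂μ) (φ ψ : Lp ℝ 2 μ) :
    ∫ z, |φ z.1| * (K z.1 z.2 * |ψ z.2|) ∂(μ.prod μ) ≤ ‖A‖ * (‖φ‖ * ‖ψ‖) := by
  have h1 : ∫ z, |φ z.1| * (K z.1 z.2 * |ψ z.2|) ∂(μ.prod μ) = ⟪|φ|, A |ψ|⟫ := by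
    rw [inner_kernelOp_eq_integral_prod hK hC hA]
    refine integral_congr_ae ?_
    have hφ := (Measure.quasiMeasurePreserving_fst (μ := μ) (ν := μ)).ae_eq (Lp.coeFn_abs φ)
    have hψ := (Measure.quasiMeasurePreserving_snd (μ := μ) (ν := μ)).ae_eq (Lp.coeFn_abs ψ)
    filter_upwards [hφ, hψ] with z hz1 hz2
    simp only [Function.comp] at hz1 hz2
    rw [hz1, hz2]
  rw [h1]
  calc ⟪|φ|, A |ψ|⟫ ≤ ‖|φ|‖ * ‖A |ψ|‖ := real_inner_le_norm _ _
    _ ≤ ‖|φ|‖ * (‖A‖ * ‖|ψ|‖) := by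
        gcongr
        exact A.le_opNorm _
    _ = ‖A‖ * (‖φ‖ * ‖ψ‖) := by rw [norm_abs_eq_norm, norm_abs_eq_norm]; ring

/-- A non-negative integrand against `μ ⊗ μ`, as a `lintegral`: `ENNReal.ofReal (∫ f) = ∫⁻ ofReal ∘ f`
for integrable `f ≥ 0`, specialised to `|φ(x)| K(x,y) |ψ(y)|`. [folklore] -/
private theorem ofReal_integral_abs_eq_lintegral {K : X → X → ℝ} {C : ℝ}
    (hK : StronglyMeasurable (uncurry K)) (hC : ∀ x y, ‖K x y‖ ≤ C) (hK0 : ∀ x y, 0 ≤ K x y)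
    (φ ψ : Lp ℝ 2 μ) :
    ENNReal.ofReal (∫ z, |φ z.1| * (K z.1 z.2 * |ψ z.2|) ∂(μ.prod μ)) =
      ∫⁻ z, ENNReal.ofReal (|φ z.1| * (K z.1 z.2 * |ψ z.2|)) ∂(μ.prod μ) :=
  ofReal_integral_eq_lintegral_ofReal (integrable_abs_mul_kernel_mul_abs hK hC hK0 φ ψ)
    (Eventually.of_forall fun _ => mul_nonneg (abs_nonneg _) (mul_nonneg (hK0 _ _) (abs_nonneg _)))

/-- **Kingman's inequality for the bilinear form.** Let `K₀, K₁, K` be non-negative, bounded, jointly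
measurable kernels on a finite measure space with `K ≤ K₀^θ K₁^{1-θ}` pointwise (`0 ≤ θ ≤ 1`), and let
`A₀, A₁, A` be the corresponding integral operators on `L²`. Then for all `φ, ψ ∈ L²`,
`⟪φ, A ψ⟫ ≤ ‖A₀‖^θ ‖A₁‖^{1-θ} ‖φ‖ ‖ψ‖`. (Reduce to `|φ|, |ψ|` by positivity, then Hölder with exponents
`1/θ`, `1/(1-θ)` on `X × X`.) [cite: BogdanovicPeperko2022, Thm. 1.1 (i), ρ = ‖·‖, n = 2]
[cite: Kingman1961, Theorem] -/
theorem inner_kernelOp_le_of_le_rpow_mul_rpow {K₀ K₁ K : X → X → ℝ} {C₀ C₁ C : ℝ}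
    (hK₀ : StronglyMeasurable (uncurry K₀)) (hC₀ : ∀ x y, ‖K₀ x y‖ ≤ C₀)
    (hK₁ : StronglyMeasurable (uncurry K₁)) (hC₁ : ∀ x y, ‖K₁ x y‖ ≤ C₁)
    (hK : StronglyMeasurable (uncurry K)) (hC : ∀ x y, ‖K x y‖ ≤ C)
    (h₀ : ∀ x y, 0 ≤ K₀ x y) (h₁ : ∀ x y, 0 ≤ K₁ x y) (h : ∀ x y, 0 ≤ K x y)
    {θ : ℝ} (hθ₀ : 0 ≤ θ) (hθ₁ : θ ≤ 1)
    (hle : ∀ x y, K x y ≤ K₀ x y ^ θ * K₁ x y ^ (1 - θ))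
    {A₀ A₁ A : Lp ℝ 2 μ →L[ℝ] Lp ℝ 2 μ}
    (hA₀ : ∀ φ : Lp ℝ 2 μ, (A₀ φ : X → ℝ) =ᵐ[μ] fun x => ∫ y, K₀ x y * φ y ∂μ)
    (hA₁ : ∀ φ : Lp ℝ 2 μ, (A₁ φ : X → ℝ) =ᵐ[μ] fun x => ∫ y, K₁ x y * φ y ∂μ)
    (hA : ∀ φ : Lp ℝ 2 μ, (A φ : X → ℝ) =ᵐ[μ] fun x => ∫ y, K x y * φ y ∂μ)
    (φ ψ : Lp ℝ 2 μ) :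
    ⟪φ, A ψ⟫ ≤ ‖A₀‖ ^ θ * ‖A₁‖ ^ (1 - θ) * (‖φ‖ * ‖ψ‖) := by
  have hθ₁' : 0 ≤ 1 - θ := sub_nonneg.mpr hθ₁
  -- the three absolute-value integrands
  set w : X × X → ℝ := fun z => |φ z.1| * |ψ z.2| with hw
  have hw0 : ∀ z, 0 ≤ w z := fun z => mul_nonneg (abs_nonneg _) (abs_nonneg _)
  set F : X × X → ℝ := fun z => |φ z.1| * (K z.1 z.2 * |ψ z.2|) with hF
  set F₀ : X × X → ℝ := fun z => |φ z.1| * (K₀ z.1 z.2 * |ψ z.2|) with hF₀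
  set F₁ : X × X → ℝ := fun z => |φ z.1| * (K₁ z.1 z.2 * |ψ z.2|) with hF₁
  have hFw : ∀ z, F z = w z * K z.1 z.2 := fun z => by simp only [hF, hw]; ring
  have hF₀w : ∀ z, F₀ z = w z * K₀ z.1 z.2 := fun z => by simp only [hF₀, hw]; ring
  have hF₁w : ∀ z, F₁ z = w z * K₁ z.1 z.2 := fun z => by simp only [hF₁, hw]; ring
  have hF0 : ∀ z, 0 ≤ F z := fun z => by rw [hFw]; exact mul_nonneg (hw0 z) (h _ _)
  have hF₀0 : ∀ z, 0 ≤ F₀ z := fun z => by rw [hF₀w]; exact mul_nonneg (hw0 z) (h₀ _ _)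
  have hF₁0 : ∀ z, 0 ≤ F₁ z := fun z => by rw [hF₁w]; exact mul_nonneg (hw0 z) (h₁ _ _)
  -- pointwise Kingman: `F ≤ F₀^θ F₁^{1-θ}`
  have hpt : ∀ z, F z ≤ F₀ z ^ θ * F₁ z ^ (1 - θ) := by
    intro z
    rw [hFw, hF₀w, hF₁w, Real.mul_rpow (hw0 z) (h₀ _ _), Real.mul_rpow (hw0 z) (h₁ _ _)]
    have hww : w z ^ θ * w z ^ (1 - θ) = w z := by
      rcases (hw0 z).eq_or_lt with hz | hz
      · rw [← hz]
        rcases hθ₀.eq_or_lt with hθ | hθ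
        · rw [← hθ, sub_zero, Real.zero_rpow one_ne_zero, mul_zero]
        · rw [Real.zero_rpow hθ.ne', zero_mul]
      · rw [← Real.rpow_add hz, add_sub_cancel, Real.rpow_one]
    calc w z * K z.1 z.2 ≤ w z * (K₀ z.1 z.2 ^ θ * K₁ z.1 z.2 ^ (1 - θ)) :=
          mul_le_mul_of_nonneg_left (hle _ _) (hw0 z)
      _ = w z ^ θ * w z ^ (1 - θ) * (K₀ z.1 z.2 ^ θ * K₁ z.1 z.2 ^ (1 - θ)) := by rw [hww]
      _ = w z ^ θ * K₀ z.1 z.2 ^ θ * (w z ^ (1 - θ) * K₁ z.1 z.2 ^ (1 - θ)) := by ring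
  -- integrability and measurability
  have hiF : Integrable F (μ.prod μ) := integrable_abs_mul_kernel_mul_abs hK hC h φ ψ
  have hiF₀ : Integrable F₀ (μ.prod μ) := integrable_abs_mul_kernel_mul_abs hK₀ hC₀ h₀ φ ψ
  have hiF₁ : Integrable F₁ (μ.prod μ) := integrable_abs_mul_kernel_mul_abs hK₁ hC₁ h₁ φ ψ
  have hmF₀ : AEMeasurable (fun z => ENNReal.ofReal (F₀ z)) (μ.prod μ) :=
    hiF₀.aestronglyMeasurable.aemeasurable.ennreal_ofReal
  have hmF₁ : AEMeasurable (fun z => ENNReal.ofReal (F₁ z)) (μ.prod μ) :=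
    hiF₁.aestronglyMeasurable.aemeasurable.ennreal_ofReal
  -- Hölder on `X × X` in the `lintegral` form
  have hH : ∫⁻ z, ENNReal.ofReal (F z) ∂(μ.prod μ) ≤
      (∫⁻ z, ENNReal.ofReal (F₀ z) ∂(μ.prod μ)) ^ θ * (∫⁻ z, ENNReal.ofReal (F₁ z) ∂(μ.prod μ)) ^ (1 - θ) := by
    calc ∫⁻ z, ENNReal.ofReal (F z) ∂(μ.prod μ)
        ≤ ∫⁻ z, ENNReal.ofReal (F₀ z) ^ θ * ENNReal.ofReal (F₁ z) ^ (1 - θ) ∂(μ.prod μ) := by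
          refine lintegral_mono fun z => ?_
          rw [ENNReal.ofReal_rpow_of_nonneg (hF₀0 z) hθ₀, ENNReal.ofReal_rpow_of_nonneg (hF₁0 z) hθ₁',
            ← ENNReal.ofReal_mul (Real.rpow_nonneg (hF₀0 z) θ)]
          exact ENNReal.ofReal_le_ofReal (hpt z)
      _ ≤ (∫⁻ z, ENNReal.ofReal (F₀ z) ∂(μ.prod μ)) ^ θ *
            (∫⁻ z, ENNReal.ofReal (F₁ z) ∂(μ.prod μ)) ^ (1 - θ) :=
          ENNReal.lintegral_mul_norm_pow_le hmF₀ hmF₁ hθ₀ hθ₁' (by ring)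
  -- back to real integrals
  have hI : ENNReal.ofReal (∫ z, F z ∂(μ.prod μ)) = ∫⁻ z, ENNReal.ofReal (F z) ∂(μ.prod μ) :=
    ofReal_integral_abs_eq_lintegral hK hC h φ ψ
  have hI₀ : ∫⁻ z, ENNReal.ofReal (F₀ z) ∂(μ.prod μ) = ENNReal.ofReal (∫ z, F₀ z ∂(μ.prod μ)) :=
    (ofReal_integral_abs_eq_lintegral hK₀ hC₀ h₀ φ ψ).symm
  have hI₁ : ∫⁻ z, ENNReal.ofReal (F₁ z) ∂(μ.prod μ) = ENNReal.ofReal (∫ z, F₁ z ∂(μ.prod μ)) :=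
    (ofReal_integral_abs_eq_lintegral hK₁ hC₁ h₁ φ ψ).symm
  have hb₀ : ∫ z, F₀ z ∂(μ.prod μ) ≤ ‖A₀‖ * (‖φ‖ * ‖ψ‖) := integral_abs_le_norm hK₀ hC₀ hA₀ φ ψ
  have hb₁ : ∫ z, F₁ z ∂(μ.prod μ) ≤ ‖A₁‖ * (‖φ‖ * ‖ψ‖) := integral_abs_le_norm hK₁ hC₁ hA₁ φ ψ
  have hn₀ : 0 ≤ ‖A₀‖ * (‖φ‖ * ‖ψ‖) := by positivity
  have hn₁ : 0 ≤ ‖A₁‖ * (‖φ‖ * ‖ψ‖) := by positivity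
  have hfin : ENNReal.ofReal (∫ z, F z ∂(μ.prod μ)) ≤
      ENNReal.ofReal ((‖A₀‖ * (‖φ‖ * ‖ψ‖)) ^ θ * (‖A₁‖ * (‖φ‖ * ‖ψ‖)) ^ (1 - θ)) := by
    rw [hI, ENNReal.ofReal_mul (Real.rpow_nonneg hn₀ θ), ← ENNReal.ofReal_rpow_of_nonneg hn₀ hθ₀,
      ← ENNReal.ofReal_rpow_of_nonneg hn₁ hθ₁']
    refine hH.trans ?_
    rw [hI₀, hI₁]
    have e₀ := ENNReal.ofReal_le_ofReal hb₀
    have e₁ := ENNReal.ofReal_le_ofReal hb₁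
    gcongr
  have hreal : ∫ z, F z ∂(μ.prod μ) ≤ (‖A₀‖ * (‖φ‖ * ‖ψ‖)) ^ θ * (‖A₁‖ * (‖φ‖ * ‖ψ‖)) ^ (1 - θ) :=
    (ENNReal.ofReal_le_ofReal_iff (by positivity)).mp hfin
  -- assemble
  have hsplit : (‖A₀‖ * (‖φ‖ * ‖ψ‖)) ^ θ * (‖A₁‖ * (‖φ‖ * ‖ψ‖)) ^ (1 - θ) =
      ‖A₀‖ ^ θ * ‖A₁‖ ^ (1 - θ) * (‖φ‖ * ‖ψ‖) := by
    have hc : 0 ≤ ‖φ‖ * ‖ψ‖ := by positivity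
    rw [Real.mul_rpow (norm_nonneg _) hc, Real.mul_rpow (norm_nonneg _) hc]
    have hcc : (‖φ‖ * ‖ψ‖) ^ θ * (‖φ‖ * ‖ψ‖) ^ (1 - θ) = ‖φ‖ * ‖ψ‖ := by
      rcases hc.eq_or_lt with hz | hz
      · rw [← hz]
        rcases hθ₀.eq_or_lt with hθ | hθ
        · rw [← hθ, sub_zero, Real.zero_rpow one_ne_zero, mul_zero]
        · rw [Real.zero_rpow hθ.ne', zero_mul]
      · rw [← Real.rpow_add hz, add_sub_cancel, Real.rpow_one]
    calc ‖A₀‖ ^ θ * (‖φ‖ * ‖ψ‖) ^ θ * (‖A₁‖ ^ (1 - θ) * (‖φ‖ * ‖ψ‖) ^ (1 - θ))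
        = ‖A₀‖ ^ θ * ‖A₁‖ ^ (1 - θ) * ((‖φ‖ * ‖ψ‖) ^ θ * (‖φ‖ * ‖ψ‖) ^ (1 - θ)) := by ring
      _ = ‖A₀‖ ^ θ * ‖A₁‖ ^ (1 - θ) * (‖φ‖ * ‖ψ‖) := by rw [hcc]
  calc ⟪φ, A ψ⟫ ≤ ∫ z, F z ∂(μ.prod μ) := inner_kernelOp_le_integral_abs hK hC h hA φ ψ
    _ ≤ (‖A₀‖ * (‖φ‖ * ‖ψ‖)) ^ θ * (‖A₁‖ * (‖φ‖ * ‖ψ‖)) ^ (1 - θ) := hreal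
    _ = ‖A₀‖ ^ θ * ‖A₁‖ ^ (1 - θ) * (‖φ‖ * ‖ψ‖) := hsplit

/-- **Kingman's inequality for the operator norm** (Drnovšek–Peperko form, `n = 2`, `L = L²(X, μ)`):
with `K₀, K₁, K ≥ 0` bounded measurable kernels on a finite measure space, `0 ≤ θ ≤ 1` and
`K ≤ K₀^θ K₁^{1-θ}` pointwise, the integral operators satisfy **`‖A‖ ≤ ‖A₀‖^θ ‖A₁‖^{1-θ}`**; in
particular the operator with kernel exactly `K₀^θ K₁^{1-θ}` (the Hadamard weighted geometric mean
`A₀^{(θ)} ∘ A₁^{(1-θ)}`) has norm at most `‖A₀‖^θ ‖A₁‖^{1-θ}`.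
[cite: BogdanovicPeperko2022, Thm. 1.1 (i), ρ = ‖·‖] [cite: Kingman1961, Theorem] -/
theorem norm_kernelOp_le_rpow_mul_rpow {K₀ K₁ K : X → X → ℝ} {C₀ C₁ C : ℝ}
    (hK₀ : StronglyMeasurable (uncurry K₀)) (hC₀ : ∀ x y, ‖K₀ x y‖ ≤ C₀)
    (hK₁ : StronglyMeasurable (uncurry K₁)) (hC₁ : ∀ x y, ‖K₁ x y‖ ≤ C₁)
    (hK : StronglyMeasurable (uncurry K)) (hC : ∀ x y, ‖K x y‖ ≤ C)
    (h₀ : ∀ x y, 0 ≤ K₀ x y) (h₁ : ∀ x y, 0 ≤ K₁ x y) (h : ∀ x y, 0 ≤ K x y)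
    {θ : ℝ} (hθ₀ : 0 ≤ θ) (hθ₁ : θ ≤ 1)
    (hle : ∀ x y, K x y ≤ K₀ x y ^ θ * K₁ x y ^ (1 - θ))
    {A₀ A₁ A : Lp ℝ 2 μ →L[ℝ] Lp ℝ 2 μ}
    (hA₀ : ∀ φ : Lp ℝ 2 μ, (A₀ φ : X → ℝ) =ᵐ[μ] fun x => ∫ y, K₀ x y * φ y ∂μ)
    (hA₁ : ∀ φ : Lp ℝ 2 μ, (A₁ φ : X → ℝ) =ᵐ[μ] fun x => ∫ y, K₁ x y * φ y ∂μ)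
    (hA : ∀ φ : Lp ℝ 2 μ, (A φ : X → ℝ) =ᵐ[μ] fun x => ∫ y, K x y * φ y ∂μ) :
    ‖A‖ ≤ ‖A₀‖ ^ θ * ‖A₁‖ ^ (1 - θ) := by
  have hM : 0 ≤ ‖A₀‖ ^ θ * ‖A₁‖ ^ (1 - θ) := by positivity
  refine ContinuousLinearMap.opNorm_le_bound _ hM fun ψ => ?_
  have hq := inner_kernelOp_le_of_le_rpow_mul_rpow hK₀ hC₀ hK₁ hC₁ hK hC h₀ h₁ h hθ₀ hθ₁ hle hA₀ hA₁ hA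
    (A ψ) ψ
  rw [real_inner_self_eq_norm_sq] at hq
  rcases (norm_nonneg (A ψ)).eq_or_lt with h0 | hpos
  · rw [← h0]; positivity
  · -- `‖Aψ‖² ≤ M ‖Aψ‖ ‖ψ‖` with `‖Aψ‖ > 0`
    have : ‖A ψ‖ * ‖A ψ‖ ≤ ‖A ψ‖ * (‖A₀‖ ^ θ * ‖A₁‖ ^ (1 - θ) * ‖ψ‖) := by
      calc ‖A ψ‖ * ‖A ψ‖ = ‖A ψ‖ ^ 2 := (sq _).symm
        _ ≤ ‖A₀‖ ^ θ * ‖A₁‖ ^ (1 - θ) * (‖A ψ‖ * ‖ψ‖) := hq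
        _ = ‖A ψ‖ * (‖A₀‖ ^ θ * ‖A₁‖ ^ (1 - θ) * ‖ψ‖) := by ring
    exact le_of_mul_le_mul_left this hpos

/-- **Monotonicity of the norm in the kernel** (the case `θ = 0`): `0 ≤ K ≤ K₁` pointwise implies
`‖A‖ ≤ ‖A₁‖`. [cite: BogdanovicPeperko2022, §1 (‖K‖ = sup over f ≥ 0; K ≤ H ⇒ monotone)] -/
theorem norm_kernelOp_mono {K₁ K : X → X → ℝ} {C₁ C : ℝ}
    (hK₁ : StronglyMeasurable (uncurry K₁)) (hC₁ : ∀ x y, ‖K₁ x y‖ ≤ C₁)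
    (hK : StronglyMeasurable (uncurry K)) (hC : ∀ x y, ‖K x y‖ ≤ C)
    (h : ∀ x y, 0 ≤ K x y) (hle : ∀ x y, K x y ≤ K₁ x y)
    {A₁ A : Lp ℝ 2 μ →L[ℝ] Lp ℝ 2 μ}
    (hA₁ : ∀ φ : Lp ℝ 2 μ, (A₁ φ : X → ℝ) =ᵐ[μ] fun x => ∫ y, K₁ x y * φ y ∂μ)
    (hA : ∀ φ : Lp ℝ 2 μ, (A φ : X → ℝ) =ᵐ[μ] fun x => ∫ y, K x y * φ y ∂μ) :
    ‖A‖ ≤ ‖A₁‖ := by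
  have h₁ : ∀ x y, 0 ≤ K₁ x y := fun x y => (h x y).trans (hle x y)
  have key := norm_kernelOp_le_rpow_mul_rpow (θ := 0) hK₁ hC₁ hK₁ hC₁ hK hC h₁ h₁ h le_rfl zero_le_one
    (fun x y => by rw [Real.rpow_zero, one_mul, sub_zero, Real.rpow_one]; exact hle x y) hA₁ hA₁ hA
  simpa only [Real.rpow_zero, one_mul, sub_zero, Real.rpow_one] using key

/-! ### Parametrised families: Kingman's log-convexity of `t ↦ ‖A t‖` -/

variable {E : Type*} [AddCommGroup E] [Module ℝ E] {D : Set E}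
  {K : E → X → X → ℝ} {A : E → Lp ℝ 2 μ →L[ℝ] Lp ℝ 2 μ}

/-- **Kingman's theorem, two-point form.** Let `t ↦ K t` be a family of non-negative, bounded, jointly
measurable kernels indexed by a convex set `D` of a real vector space, which is POINTWISE LOG-CONVEX:
`K(θa + (1-θ)b)(x,y) ≤ K(a)(x,y)^θ K(b)(x,y)^{1-θ}` for `a, b ∈ D`, `0 ≤ θ ≤ 1`. Then the norms of the
corresponding integral operators on `L²` satisfy `‖A(θa + (1-θ)b)‖ ≤ ‖A a‖^θ ‖A b‖^{1-θ}`.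
[cite: Kingman1961, Theorem] [cite: BogdanovicPeperko2022, Thm. 1.1 (i)] -/
theorem norm_kernelOp_convexComb_le
    (hKm : ∀ t ∈ D, StronglyMeasurable (uncurry (K t)))
    (hKb : ∀ t ∈ D, ∃ C : ℝ, ∀ x y, ‖K t x y‖ ≤ C)
    (hK0 : ∀ t ∈ D, ∀ x y, 0 ≤ K t x y)
    (hA : ∀ t ∈ D, ∀ φ : Lp ℝ 2 μ, (A t φ : X → ℝ) =ᵐ[μ] fun x => ∫ y, K t x y * φ y ∂μ)
    (hlog : ∀ a ∈ D, ∀ b ∈ D, ∀ θ : ℝ, 0 ≤ θ → θ ≤ 1 →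
      ∀ x y, K (θ • a + (1 - θ) • b) x y ≤ K a x y ^ θ * K b x y ^ (1 - θ))
    (hD : Convex ℝ D) {a b : E} (ha : a ∈ D) (hb : b ∈ D) {θ : ℝ} (hθ₀ : 0 ≤ θ) (hθ₁ : θ ≤ 1) :
    ‖A (θ • a + (1 - θ) • b)‖ ≤ ‖A a‖ ^ θ * ‖A b‖ ^ (1 - θ) := by
  have hc : θ • a + (1 - θ) • b ∈ D := hD ha hb hθ₀ (sub_nonneg.mpr hθ₁) (by ring)
  obtain ⟨Ca, hCa⟩ := hKb a ha
  obtain ⟨Cb, hCb⟩ := hKb b hb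
  obtain ⟨Cc, hCc⟩ := hKb _ hc
  exact norm_kernelOp_le_rpow_mul_rpow (hKm a ha) hCa (hKm b hb) hCb (hKm _ hc) hCc (hK0 a ha) (hK0 b hb)
    (hK0 _ hc) hθ₀ hθ₁ (hlog a ha b hb θ hθ₀ hθ₁) (hA a ha) (hA b hb) (hA _ hc)

/-- **Kingman's log-convexity of the operator norm**: under the hypotheses of
`norm_kernelOp_convexComb_le`, if no `A t` (`t ∈ D`) is the zero operator then `t ↦ log ‖A t‖` is a
convex function on `D`. [cite: Kingman1961, Theorem] [cite: BogdanovicPeperko2022, Thm. 1.1 (i)] -/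
theorem convexOn_log_norm_kernelOp
    (hKm : ∀ t ∈ D, StronglyMeasurable (uncurry (K t)))
    (hKb : ∀ t ∈ D, ∃ C : ℝ, ∀ x y, ‖K t x y‖ ≤ C)
    (hK0 : ∀ t ∈ D, ∀ x y, 0 ≤ K t x y)
    (hA : ∀ t ∈ D, ∀ φ : Lp ℝ 2 μ, (A t φ : X → ℝ) =ᵐ[μ] fun x => ∫ y, K t x y * φ y ∂μ)
    (hlog : ∀ a ∈ D, ∀ b ∈ D, ∀ θ : ℝ, 0 ≤ θ → θ ≤ 1 →
      ∀ x y, K (θ • a + (1 - θ) • b) x y ≤ K a x y ^ θ * K b x y ^ (1 - θ))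
    (hD : Convex ℝ D) (hne : ∀ t ∈ D, A t ≠ 0) :
    ConvexOn ℝ D (fun t => Real.log ‖A t‖) := by
  refine ⟨hD, fun a ha b hb θ η hθ hη hθη => ?_⟩
  have hη' : η = 1 - θ := by linarith
  subst hη'
  have hc : θ • a + (1 - θ) • b ∈ D := hD ha hb hθ hη hθη
  have hθ₁ : θ ≤ 1 := by linarith
  have key := norm_kernelOp_convexComb_le hKm hKb hK0 hA hlog hD ha hb hθ hθ₁
  have hpa : 0 < ‖A a‖ := norm_pos_iff.mpr (hne a ha)
  have hpb : 0 < ‖A b‖ := norm_pos_iff.mpr (hne b hb)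
  have hpc : 0 < ‖A (θ • a + (1 - θ) • b)‖ := norm_pos_iff.mpr (hne _ hc)
  dsimp only
  rw [smul_eq_mul, smul_eq_mul]
  calc Real.log ‖A (θ • a + (1 - θ) • b)‖ ≤ Real.log (‖A a‖ ^ θ * ‖A b‖ ^ (1 - θ)) :=
        Real.log_le_log hpc key
    _ = θ * Real.log ‖A a‖ + (1 - θ) * Real.log ‖A b‖ := by
        rw [Real.log_mul (Real.rpow_pos_of_pos hpa θ).ne' (Real.rpow_pos_of_pos hpb _).ne',
          Real.log_rpow hpa, Real.log_rpow hpb]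

end Kingman

/-! ## 2. The secant bracket for a function touching a convex function from below -/

section SecantBracket

/-- **Secant bracket.** Let `f` be convex on `[β-h, β+h]` (`h > 0`), and let `g ≤ f` near `β` with
`g β = f β` be differentiable at `β` with derivative `g'`. Then the two secant slopes of `f` bracket `g'`:
`(f β - f (β-h))/h ≤ g' ≤ (f (β+h) - f β)/h`. (The difference quotients of `g` at `β` tend to `g'` and are
squeezed by those of `f`, which are monotone in the step: `(f(β+s)-f β)/s ≤ (f(β+h)-f β)/h` and
`(f β-f(β-h))/h ≤ (f β-f(β-s))/s` for `0 < s ≤ h`.)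
[cite: Dudley2002, §6.3 Prop. 6.3.2 and Cor. 6.3.3 (monotone difference quotients of a convex function)] -/
theorem secant_le_hasDerivAt_le_secant {f g : ℝ → ℝ} {β h g' : ℝ} (hh : 0 < h)
    (hf : ConvexOn ℝ (Icc (β - h) (β + h)) f) (hle : ∀ᶠ t in 𝓝 β, g t ≤ f t) (heq : g β = f β)
    (hg : HasDerivAt g g' β) :
    (f β - f (β - h)) / h ≤ g' ∧ g' ≤ (f (β + h) - f β) / h := by
  have hβ : β ∈ Icc (β - h) (β + h) := ⟨by linarith, by linarith⟩
  -- `g (β + s) ≤ f (β + s)` for `s` near `0`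
  have hle0 : ∀ᶠ s in 𝓝 (0 : ℝ), g (β + s) ≤ f (β + s) := by
    have : Tendsto (fun s : ℝ => β + s) (𝓝 0) (𝓝 β) := by
      simpa using tendsto_const_nhds.add (tendsto_id (α := ℝ) (x := 𝓝 0))
    exact this.eventually hle
  constructor
  · -- left secant
    have hlim := hg.tendsto_slope_zero_left
    have hev : ∀ᶠ s in 𝓝[<] (0 : ℝ), (f β - f (β - h)) / h ≤ s⁻¹ • (g (β + s) - g β) := by
      have h1 : ∀ᶠ s in 𝓝[<] (0 : ℝ), s ∈ Ioo (-h) 0 := Ioo_mem_nhdsLT (by linarith)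
      filter_upwards [h1, nhdsWithin_le_nhds hle0] with s hs hgs
      have hs0 : s < 0 := hs.2
      have hsI : β + s ∈ Icc (β - h) (β + h) := ⟨by linarith [hs.1], by linarith⟩
      have hlI : β - h ∈ Icc (β - h) (β + h) := ⟨le_rfl, by linarith⟩
      -- monotone secants of `f` through `β`: points `β - h ≤ β + s`
      have hsec := hf.secant_mono hβ hlI hsI (by linarith) (by linarith) (by linarith [hs.1])
      -- `(f(β-h) - f β)/(β-h-β) ≤ (f(β+s) - f β)/(β+s-β)`
      have e1 : (f (β - h) - f β) / (β - h - β) = (f β - f (β - h)) / h := by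
        rw [show β - h - β = -h by ring, div_neg, ← neg_div, neg_sub]
      have e2 : (f (β + s) - f β) / (β + s - β) = s⁻¹ * (f (β + s) - f β) := by
        rw [show β + s - β = s by ring, div_eq_inv_mul]
      rw [e1, e2] at hsec
      refine hsec.trans ?_
      rw [smul_eq_mul]
      -- `s < 0`, `g (β+s) ≤ f (β+s)`, `g β = f β`
      have : s⁻¹ * (f (β + s) - f β) ≤ s⁻¹ * (g (β + s) - g β) :=
        mul_le_mul_of_nonpos_left (by rw [heq]; linarith) (inv_nonpos.mpr hs0.le)
      exact this
    exact ge_of_tendsto hlim hev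
  · -- right secant
    have hlim := hg.tendsto_slope_zero_right
    have hev : ∀ᶠ s in 𝓝[>] (0 : ℝ), s⁻¹ • (g (β + s) - g β) ≤ (f (β + h) - f β) / h := by
      have h1 : ∀ᶠ s in 𝓝[>] (0 : ℝ), s ∈ Ioo 0 h := Ioo_mem_nhdsGT hh
      filter_upwards [h1, nhdsWithin_le_nhds hle0] with s hs hgs
      have hs0 : 0 < s := hs.1
      have hsI : β + s ∈ Icc (β - h) (β + h) := ⟨by linarith, by linarith [hs.2]⟩
      have hrI : β + h ∈ Icc (β - h) (β + h) := ⟨by linarith, le_rfl⟩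
      have hsec := hf.secant_mono hβ hsI hrI (by linarith) (by linarith) (by linarith [hs.2])
      have e1 : (f (β + h) - f β) / (β + h - β) = (f (β + h) - f β) / h := by
        rw [show β + h - β = h by ring]
      have e2 : (f (β + s) - f β) / (β + s - β) = s⁻¹ * (f (β + s) - f β) := by
        rw [show β + s - β = s by ring, div_eq_inv_mul]
      rw [e1, e2] at hsec
      refine le_trans ?_ hsec
      rw [smul_eq_mul]
      exact mul_le_mul_of_nonneg_left (by rw [heq]; linarith) (inv_nonneg.mpr hs0.le)
    exact le_of_tendsto hlim hev

variable {H : Type*} [NormedAddCommGroup H] [InnerProductSpace ℝ H]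

/-- **The secant bracket for a Hellmann–Feynman value.** Let `t ↦ T t` be bounded operators on a real
Hilbert space such that `t ↦ log ‖T t‖` is convex on `[β-h, β+h]` (`h > 0`), let `ψ` be a unit vector
with `⟪ψ, T β ψ⟫ = ‖T β‖ > 0` (e.g. a normalised top eigenvector of a positive operator), and suppose
`t ↦ ⟪ψ, T t ψ⟫` has derivative `g'` at `β` (the Hellmann–Feynman value). Then
`(log ‖T β‖ - log ‖T (β-h)‖)/h ≤ g'/‖T β‖ ≤ (log ‖T (β+h)‖ - log ‖T β‖)/h` — the two secant slopes of
the convex function `log ‖T ·‖` through `β - h, β, β + h` enclose `g'/‖T β‖`, with no differentiability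
or simplicity assumption on the top of the spectrum (`⟪ψ, T t ψ⟫ ≤ ‖T t‖` touches `‖T ·‖` from below at
`β`, and `secant_le_hasDerivAt_le_secant`). [cite: Dudley2002, §6.3 Cor. 6.3.3]
[cite: Kingman1961, Theorem (log-convexity of the top eigenvalue as the source of such `f`)] -/
theorem log_norm_secant_bracket (T : ℝ → H →L[ℝ] H) {β h : ℝ} (hh : 0 < h)
    (hconv : ConvexOn ℝ (Icc (β - h) (β + h)) (fun t => Real.log ‖T t‖))
    {ψ : H} (hψ : ‖ψ‖ = 1) (htop : ⟪ψ, T β ψ⟫ = ‖T β‖) (hpos : 0 < ‖T β‖)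
    {g' : ℝ} (hg : HasDerivAt (fun t => ⟪ψ, T t ψ⟫) g' β) :
    (Real.log ‖T β‖ - Real.log ‖T (β - h)‖) / h ≤ g' / ‖T β‖ ∧
      g' / ‖T β‖ ≤ (Real.log ‖T (β + h)‖ - Real.log ‖T β‖) / h := by
  -- `⟪ψ, T t ψ⟫ > 0` near `β` (continuity at `β`, value `‖T β‖ > 0`)
  have hposβ : 0 < ⟪ψ, T β ψ⟫ := by rw [htop]; exact hpos
  have hev : ∀ᶠ t in 𝓝 β, 0 < ⟪ψ, T t ψ⟫ :=
    hg.continuousAt.eventually (lt_mem_nhds hposβ)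
  -- the touching function `g t = log ⟪ψ, T t ψ⟫`
  have hle : ∀ᶠ t in 𝓝 β, Real.log ⟪ψ, T t ψ⟫ ≤ Real.log ‖T t‖ := by
    filter_upwards [hev] with t ht
    refine Real.log_le_log ht ?_
    calc ⟪ψ, T t ψ⟫ ≤ ‖ψ‖ * ‖T t ψ‖ := real_inner_le_norm _ _
      _ ≤ ‖ψ‖ * (‖T t‖ * ‖ψ‖) := by gcongr; exact (T t).le_opNorm ψ
      _ = ‖T t‖ := by rw [hψ, one_mul, mul_one]
  have heq : Real.log ⟪ψ, T β ψ⟫ = Real.log ‖T β‖ := by rw [htop]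
  have hderiv : HasDerivAt (fun t => Real.log ⟪ψ, T t ψ⟫) (g' / ⟪ψ, T β ψ⟫) β := hg.log hposβ.ne'
  rw [htop] at hderiv
  exact secant_le_hasDerivAt_le_secant hh hconv hle heq hderiv

end SecantBracket

/-! ## 3. The Leibniz rule for the bilinear form of a kernel-operator family (Hellmann–Feynman numerator) -/

section Leibniz

variable {X : Type*} [MeasurableSpace X] {μ : Measure X} [IsFiniteMeasure μ]

/-- **Differentiation under the integral sign for `t ↦ ⟪φ, A_t ψ⟫`.** Let `t ↦ K t` be bounded jointly
measurable kernels on a finite measure space, for `t` in a neighbourhood `s` of `t₀`, with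
`HasDerivAt (K · x y) (K' t x y) t` on `s`, the derivative kernels uniformly bounded on `s`
(`‖K' t x y‖ ≤ C'`) and `K' t₀` jointly measurable, and let `A t` be bounded operators on `L²` given a.e.
by the kernels `K t`. Then for all `φ, ψ ∈ L²`,
`HasDerivAt (t ↦ ⟪φ, A t ψ⟫) (∫ φ(x) K'_{t₀}(x,y) ψ(y) d(μ⊗μ)) t₀` — the vector `φ, ψ` are FROZEN and
only the kernel is differentiated (dominated convergence, Mathlib's
`hasDerivAt_integral_of_dominated_loc_of_deriv_le` on `X × X` with the integrable majorant
`|φ(x)| C' |ψ(y)|`). With `φ = ψ = ψ₀` a top eigenvector this derivative is the Hellmann–Feynman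
numerator bracketed by `log_norm_secant_bracket`. [cite: Dudley2002, §6.3 (used with Cor. 6.3.3 in
`log_norm_secant_bracket`); Leibniz rule: folklore] -/
theorem hasDerivAt_inner_kernelOp {K K' : ℝ → X → X → ℝ} {A : ℝ → Lp ℝ 2 μ →L[ℝ] Lp ℝ 2 μ}
    {t₀ C C' : ℝ} {s : Set ℝ} (hs : s ∈ 𝓝 t₀)
    (hKm : ∀ t ∈ s, StronglyMeasurable (uncurry (K t))) (hKb : ∀ t ∈ s, ∀ x y, ‖K t x y‖ ≤ C)
    (hK'm : StronglyMeasurable (uncurry (K' t₀))) (hK'b : ∀ t ∈ s, ∀ x y, ‖K' t x y‖ ≤ C')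
    (hderiv : ∀ t ∈ s, ∀ x y, HasDerivAt (fun r => K r x y) (K' t x y) t)
    (hA : ∀ t ∈ s, ∀ φ : Lp ℝ 2 μ, (A t φ : X → ℝ) =ᵐ[μ] fun x => ∫ y, K t x y * φ y ∂μ)
    (φ ψ : Lp ℝ 2 μ) :
    HasDerivAt (fun t => ⟪φ, A t ψ⟫) (∫ z, φ z.1 * (K' t₀ z.1 z.2 * ψ z.2) ∂(μ.prod μ)) t₀ := by
  have ht₀ : t₀ ∈ s := mem_of_mem_nhds hs
  -- the form as a parametric integral over `X × X`, for `t ∈ s`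
  have hform : (fun t => ⟪φ, A t ψ⟫) =ᶠ[𝓝 t₀]
      fun t => ∫ z, φ z.1 * (K t z.1 z.2 * ψ z.2) ∂(μ.prod μ) := by
    filter_upwards [hs] with t ht
    exact inner_kernelOp_eq_integral_prod (hKm t ht) (hKb t ht) (hA t ht) φ ψ
  refine HasDerivAt.congr_of_eventuallyEq ?_ hform
  -- dominated differentiation on `X × X`
  have key := hasDerivAt_integral_of_dominated_loc_of_deriv_le (μ := μ.prod μ)
    (F := fun t (z : X × X) => φ z.1 * (K t z.1 z.2 * ψ z.2))
    (F' := fun t (z : X × X) => φ z.1 * (K' t z.1 z.2 * ψ z.2))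
    (bound := fun z : X × X => |φ z.1| * (C' * |ψ z.2|)) hs ?_ ?_ ?_ ?_ ?_ ?_
  · exact key.2
  · filter_upwards [hs] with t ht
    exact (integrable_mul_kernel_mul (hKm t ht) (hKb t ht) φ ψ).aestronglyMeasurable
  · exact integrable_mul_kernel_mul (hKm t₀ ht₀) (hKb t₀ ht₀) φ ψ
  · exact (integrable_mul_kernel_mul hK'm (hK'b t₀ ht₀) φ ψ).aestronglyMeasurable
  · refine Eventually.of_forall fun z t ht => ?_
    have hb : |K' t z.1 z.2| ≤ C' := by
      have := hK'b t ht z.1 z.2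
      rwa [Real.norm_eq_abs] at this
    change ‖φ z.1 * (K' t z.1 z.2 * ψ z.2)‖ ≤ |φ z.1| * (C' * |ψ z.2|)
    rw [Real.norm_eq_abs, abs_mul, abs_mul]
    exact mul_le_mul_of_nonneg_left (mul_le_mul_of_nonneg_right hb (abs_nonneg _)) (abs_nonneg _)
  · exact (((Lp.memLp φ).integrable one_le_two).abs).mul_prod
      ((((Lp.memLp ψ).integrable one_le_two).abs).const_mul C')
  · refine Eventually.of_forall fun z t ht => ?_
    exact ((hderiv t ht z.1 z.2).mul_const (ψ z.2)).const_mul (φ z.1)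

/-- The same derivative, identified with the form of an operator `A'` carrying the derivative kernel
`K' t₀`: `HasDerivAt (t ↦ ⟪φ, A t ψ⟫) ⟪φ, A' ψ⟫ t₀`. [cite: Dudley2002, §6.3; Leibniz rule: folklore] -/
theorem hasDerivAt_inner_kernelOp' {K K' : ℝ → X → X → ℝ} {A : ℝ → Lp ℝ 2 μ →L[ℝ] Lp ℝ 2 μ}
    {A' : Lp ℝ 2 μ →L[ℝ] Lp ℝ 2 μ} {t₀ C C' : ℝ} {s : Set ℝ} (hs : s ∈ 𝓝 t₀)
    (hKm : ∀ t ∈ s, StronglyMeasurable (uncurry (K t))) (hKb : ∀ t ∈ s, ∀ x y, ‖K t x y‖ ≤ C)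
    (hK'm : StronglyMeasurable (uncurry (K' t₀))) (hK'b : ∀ t ∈ s, ∀ x y, ‖K' t x y‖ ≤ C')
    (hderiv : ∀ t ∈ s, ∀ x y, HasDerivAt (fun r => K r x y) (K' t x y) t)
    (hA : ∀ t ∈ s, ∀ φ : Lp ℝ 2 μ, (A t φ : X → ℝ) =ᵐ[μ] fun x => ∫ y, K t x y * φ y ∂μ)
    (hA' : ∀ φ : Lp ℝ 2 μ, (A' φ : X → ℝ) =ᵐ[μ] fun x => ∫ y, K' t₀ x y * φ y ∂μ)
    (φ ψ : Lp ℝ 2 μ) :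
    HasDerivAt (fun t => ⟪φ, A t ψ⟫) ⟪φ, A' ψ⟫ t₀ := by
  rw [inner_kernelOp_eq_integral_prod hK'm (hK'b t₀ (mem_of_mem_nhds hs)) hA' φ ψ]
  exact hasDerivAt_inner_kernelOp hs hKm hKb hK'm hK'b hderiv hA φ ψ

end Leibniz

/-! ## 4. General chords: any secant on the left of `β` and any secant on the right of `β` -/

section GeneralChords

/-- **Left secant through `β`**: `f` convex on `[β-h, β]`, `g ≤ f` near `β`, `g β = f β`, `g` differentiable
at `β` ⇒ `(f β - f (β-h))/h ≤ g'(β)`. [cite: Dudley2002, §6.3 Cor. 6.3.3] -/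
theorem left_secant_le_of_hasDerivAt {f g : ℝ → ℝ} {β h g' : ℝ} (hh : 0 < h)
    (hf : ConvexOn ℝ (Icc (β - h) β) f) (hle : ∀ᶠ t in 𝓝 β, g t ≤ f t) (heq : g β = f β)
    (hg : HasDerivAt g g' β) : (f β - f (β - h)) / h ≤ g' := by
  have hβ : β ∈ Icc (β - h) β := ⟨by linarith, le_rfl⟩
  have hle0 : ∀ᶠ s in 𝓝 (0 : ℝ), g (β + s) ≤ f (β + s) := by
    have : Tendsto (fun s : ℝ => β + s) (𝓝 0) (𝓝 β) := by
      simpa using tendsto_const_nhds.add (tendsto_id (α := ℝ) (x := 𝓝 0))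
    exact this.eventually hle
  have hlim := hg.tendsto_slope_zero_left
  have hev : ∀ᶠ s in 𝓝[<] (0 : ℝ), (f β - f (β - h)) / h ≤ s⁻¹ • (g (β + s) - g β) := by
    have h1 : ∀ᶠ s in 𝓝[<] (0 : ℝ), s ∈ Ioo (-h) 0 := Ioo_mem_nhdsLT (by linarith)
    filter_upwards [h1, nhdsWithin_le_nhds hle0] with s hs hgs
    have hs0 : s < 0 := hs.2
    have hsI : β + s ∈ Icc (β - h) β := ⟨by linarith [hs.1], by linarith⟩
    have hlI : β - h ∈ Icc (β - h) β := ⟨le_rfl, by linarith⟩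
    have hsec := hf.secant_mono hβ hlI hsI (by linarith) (by linarith) (by linarith [hs.1])
    have e1 : (f (β - h) - f β) / (β - h - β) = (f β - f (β - h)) / h := by
      rw [show β - h - β = -h by ring, div_neg, ← neg_div, neg_sub]
    have e2 : (f (β + s) - f β) / (β + s - β) = s⁻¹ * (f (β + s) - f β) := by
      rw [show β + s - β = s by ring, div_eq_inv_mul]
    rw [e1, e2] at hsec
    refine hsec.trans ?_
    rw [smul_eq_mul]
    exact mul_le_mul_of_nonpos_left (by rw [heq]; linarith) (inv_nonpos.mpr hs0.le)
  exact ge_of_tendsto hlim hev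

/-- **Right secant through `β`**: `f` convex on `[β, β+h]`, `g ≤ f` near `β`, `g β = f β`, `g`
differentiable at `β` ⇒ `g'(β) ≤ (f (β+h) - f β)/h`. [cite: Dudley2002, §6.3 Cor. 6.3.3] -/
theorem hasDerivAt_le_right_secant {f g : ℝ → ℝ} {β h g' : ℝ} (hh : 0 < h)
    (hf : ConvexOn ℝ (Icc β (β + h)) f) (hle : ∀ᶠ t in 𝓝 β, g t ≤ f t) (heq : g β = f β)
    (hg : HasDerivAt g g' β) : g' ≤ (f (β + h) - f β) / h := by
  have hβ : β ∈ Icc β (β + h) := ⟨le_rfl, by linarith⟩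
  have hle0 : ∀ᶠ s in 𝓝 (0 : ℝ), g (β + s) ≤ f (β + s) := by
    have : Tendsto (fun s : ℝ => β + s) (𝓝 0) (𝓝 β) := by
      simpa using tendsto_const_nhds.add (tendsto_id (α := ℝ) (x := 𝓝 0))
    exact this.eventually hle
  have hlim := hg.tendsto_slope_zero_right
  have hev : ∀ᶠ s in 𝓝[>] (0 : ℝ), s⁻¹ • (g (β + s) - g β) ≤ (f (β + h) - f β) / h := by
    have h1 : ∀ᶠ s in 𝓝[>] (0 : ℝ), s ∈ Ioo 0 h := Ioo_mem_nhdsGT hh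
    filter_upwards [h1, nhdsWithin_le_nhds hle0] with s hs hgs
    have hs0 : 0 < s := hs.1
    have hsI : β + s ∈ Icc β (β + h) := ⟨by linarith, by linarith [hs.2]⟩
    have hrI : β + h ∈ Icc β (β + h) := ⟨by linarith, le_rfl⟩
    have hsec := hf.secant_mono hβ hsI hrI (by linarith) (by linarith) (by linarith [hs.2])
    have e1 : (f (β + h) - f β) / (β + h - β) = (f (β + h) - f β) / h := by
      rw [show β + h - β = h by ring]
    have e2 : (f (β + s) - f β) / (β + s - β) = s⁻¹ * (f (β + s) - f β) := by
      rw [show β + s - β = s by ring, div_eq_inv_mul]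
    rw [e1, e2] at hsec
    refine le_trans ?_ hsec
    rw [smul_eq_mul]
    exact mul_le_mul_of_nonneg_left (by rw [heq]; linarith) (inv_nonneg.mpr hs0.le)
  exact le_of_tendsto hlim hev

/-- **Any chord on the left of `β` lies below `g'(β)`**: for `x₁ < x₂ ≤ β` and `f` convex on `[x₁, β]`
touched from below at `β` by `g` (differentiable at `β`), `(f x₂ - f x₁)/(x₂ - x₁) ≤ g'(β)` (chords of a
convex function increase: `slope(x₁,x₂) ≤ slope(x₂,β) ≤ g'`). [cite: Dudley2002, §6.3 Prop. 6.3.2, Cor. 6.3.3] -/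
theorem secant_le_of_hasDerivAt {f g : ℝ → ℝ} {β x₁ x₂ g' : ℝ} (h12 : x₁ < x₂) (h2 : x₂ ≤ β)
    (hf : ConvexOn ℝ (Icc x₁ β) f) (hle : ∀ᶠ t in 𝓝 β, g t ≤ f t) (heq : g β = f β)
    (hg : HasDerivAt g g' β) : (f x₂ - f x₁) / (x₂ - x₁) ≤ g' := by
  rcases h2.eq_or_lt with rfl | h2'
  · -- the chord ends at `β`
    have h := left_secant_le_of_hasDerivAt (h := x₂ - x₁) (by linarith)
      (by rwa [show x₂ - (x₂ - x₁) = x₁ by ring]) hle heq hg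
    rwa [show x₂ - (x₂ - x₁) = x₁ by ring] at h
  · have hadj := hf.slope_mono_adjacent ⟨le_rfl, by linarith⟩ ⟨by linarith, le_rfl⟩ h12 h2'
    refine hadj.trans ?_
    have h := left_secant_le_of_hasDerivAt (h := β - x₂) (by linarith)
      (hf.subset (Icc_subset_Icc (by linarith) le_rfl) (convex_Icc _ _)) hle heq hg
    rwa [show β - (β - x₂) = x₂ by ring] at h

/-- **Any chord on the right of `β` lies above `g'(β)`**: for `β ≤ x₃ < x₄` and `f` convex on `[β, x₄]`
touched from below at `β` by `g`, `g'(β) ≤ (f x₄ - f x₃)/(x₄ - x₃)`.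
[cite: Dudley2002, §6.3 Prop. 6.3.2, Cor. 6.3.3] -/
theorem hasDerivAt_le_secant {f g : ℝ → ℝ} {β x₃ x₄ g' : ℝ} (h3 : β ≤ x₃) (h34 : x₃ < x₄)
    (hf : ConvexOn ℝ (Icc β x₄) f) (hle : ∀ᶠ t in 𝓝 β, g t ≤ f t) (heq : g β = f β)
    (hg : HasDerivAt g g' β) : g' ≤ (f x₄ - f x₃) / (x₄ - x₃) := by
  rcases h3.eq_or_lt with rfl | h3'
  · have h := hasDerivAt_le_right_secant (h := x₄ - β) (by linarith)
      (by rwa [show β + (x₄ - β) = x₄ by ring]) hle heq hg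
    rwa [show β + (x₄ - β) = x₄ by ring] at h
  · have hadj := hf.slope_mono_adjacent ⟨le_rfl, by linarith⟩ ⟨by linarith, le_rfl⟩ h3' h34
    refine le_trans ?_ hadj
    have h := hasDerivAt_le_right_secant (h := x₃ - β) (by linarith)
      (hf.subset (Icc_subset_Icc le_rfl (by linarith)) (convex_Icc _ _)) hle heq hg
    rwa [show β + (x₃ - β) = x₃ by ring] at h

variable {H : Type*} [NormedAddCommGroup H] [InnerProductSpace ℝ H]

/-- **The secant bracket for a Hellmann–Feynman value, general chords** (the form used by secant
certificates with sample points `x₁ < x₂ ≤ β ≤ x₃ < x₄`): with `t ↦ log ‖T t‖` convex on `[x₁, x₄]`, `ψ` a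
unit vector with `⟪ψ, T β ψ⟫ = ‖T β‖ > 0` and `HasDerivAt (t ↦ ⟪ψ, T t ψ⟫) g' β`,
`(log ‖T x₂‖ - log ‖T x₁‖)/(x₂ - x₁) ≤ g'/‖T β‖ ≤ (log ‖T x₄‖ - log ‖T x₃‖)/(x₄ - x₃)`.
[cite: Dudley2002, §6.3 Cor. 6.3.3] [cite: Kingman1961, Theorem] -/
theorem log_norm_secant_bracket' (T : ℝ → H →L[ℝ] H) {β x₁ x₂ x₃ x₄ : ℝ} (h12 : x₁ < x₂)
    (h2 : x₂ ≤ β) (h3 : β ≤ x₃) (h34 : x₃ < x₄)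
    (hconv : ConvexOn ℝ (Icc x₁ x₄) (fun t => Real.log ‖T t‖))
    {ψ : H} (hψ : ‖ψ‖ = 1) (htop : ⟪ψ, T β ψ⟫ = ‖T β‖) (hpos : 0 < ‖T β‖)
    {g' : ℝ} (hg : HasDerivAt (fun t => ⟪ψ, T t ψ⟫) g' β) :
    (Real.log ‖T x₂‖ - Real.log ‖T x₁‖) / (x₂ - x₁) ≤ g' / ‖T β‖ ∧
      g' / ‖T β‖ ≤ (Real.log ‖T x₄‖ - Real.log ‖T x₃‖) / (x₄ - x₃) := by
  have hposβ : 0 < ⟪ψ, T β ψ⟫ := by rw [htop]; exact hpos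
  have hev : ∀ᶠ t in 𝓝 β, 0 < ⟪ψ, T t ψ⟫ :=
    hg.continuousAt.eventually (lt_mem_nhds hposβ)
  have hle : ∀ᶠ t in 𝓝 β, Real.log ⟪ψ, T t ψ⟫ ≤ Real.log ‖T t‖ := by
    filter_upwards [hev] with t ht
    refine Real.log_le_log ht ?_
    calc ⟪ψ, T t ψ⟫ ≤ ‖ψ‖ * ‖T t ψ‖ := real_inner_le_norm _ _
      _ ≤ ‖ψ‖ * (‖T t‖ * ‖ψ‖) := by gcongr; exact (T t).le_opNorm ψ
      _ = ‖T t‖ := by rw [hψ, one_mul, mul_one]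
  have heq : Real.log ⟪ψ, T β ψ⟫ = Real.log ‖T β‖ := by rw [htop]
  have hderiv : HasDerivAt (fun t => Real.log ⟪ψ, T t ψ⟫) (g' / ⟪ψ, T β ψ⟫) β := hg.log hposβ.ne'
  rw [htop] at hderiv
  exact ⟨secant_le_of_hasDerivAt h12 h2 (hconv.subset (Icc_subset_Icc le_rfl (by linarith)) (convex_Icc _ _))
      hle heq hderiv,
    hasDerivAt_le_secant h3 h34 (hconv.subset (Icc_subset_Icc (by linarith) le_rfl) (convex_Icc _ _))
      hle heq hderiv⟩

end GeneralChords

/-! ## 5. Monotonicity: touching derivatives of a convex function increase (Griffiths-type monotonicity of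
Hellmann–Feynman values in the coupling) -/

section Monotone

/-- **Touching derivatives of a convex function are ordered.** If `f` is convex on `[β₁, β₂]` (`β₁ < β₂`),
`g₁ ≤ f` near `β₁` with `g₁ β₁ = f β₁` and derivative `d₁` at `β₁`, and `g₂ ≤ f` near `β₂` with
`g₂ β₂ = f β₂` and derivative `d₂` at `β₂`, then `d₁ ≤ (f β₂ - f β₁)/(β₂ - β₁) ≤ d₂`; in particular
`d₁ ≤ d₂`. [cite: Dudley2002, §6.3 Cor. 6.3.3 (one-sided derivatives of a convex function are non-decreasing)] -/
theorem hasDerivAt_le_slope_le_hasDerivAt {f g₁ g₂ : ℝ → ℝ} {β₁ β₂ d₁ d₂ : ℝ} (hβ : β₁ < β₂)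
    (hf : ConvexOn ℝ (Icc β₁ β₂) f)
    (hle₁ : ∀ᶠ t in 𝓝 β₁, g₁ t ≤ f t) (heq₁ : g₁ β₁ = f β₁) (hg₁ : HasDerivAt g₁ d₁ β₁)
    (hle₂ : ∀ᶠ t in 𝓝 β₂, g₂ t ≤ f t) (heq₂ : g₂ β₂ = f β₂) (hg₂ : HasDerivAt g₂ d₂ β₂) :
    d₁ ≤ (f β₂ - f β₁) / (β₂ - β₁) ∧ (f β₂ - f β₁) / (β₂ - β₁) ≤ d₂ :=
  ⟨hasDerivAt_le_secant le_rfl hβ hf hle₁ heq₁ hg₁, secant_le_of_hasDerivAt hβ le_rfl hf hle₂ heq₂ hg₂⟩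

variable {H : Type*} [NormedAddCommGroup H] [InnerProductSpace ℝ H]

/-- **Hellmann–Feynman values are non-decreasing in the coupling.** Let `t ↦ T t` be bounded operators on
a real Hilbert space with `t ↦ log ‖T t‖` convex on `[β₁, β₂]` (`β₁ < β₂`), and for `i = 1, 2` let `ψᵢ` be a
unit vector with `⟪ψᵢ, T βᵢ ψᵢ⟫ = ‖T βᵢ‖ > 0` and `gᵢ' = d/dt ⟪ψᵢ, T t ψᵢ⟫|_{βᵢ}`. Then
`g₁'/‖T β₁‖ ≤ (log ‖T β₂‖ - log ‖T β₁‖)/(β₂ - β₁) ≤ g₂'/‖T β₂‖` — the normalised Hellmann–Feynman values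
increase with the coupling (for transfer operators: the plaquette expectation conjugate to a coupling is
monotone in that coupling, the `L_t = ∞` analogue of `d⟨P⟩/dβ = Var ≥ 0`).
[cite: Dudley2002, §6.3 Cor. 6.3.3] [cite: Kingman1961, Theorem] -/
theorem log_norm_hasDerivAt_div_mono (T : ℝ → H →L[ℝ] H) {β₁ β₂ : ℝ} (hβ : β₁ < β₂)
    (hconv : ConvexOn ℝ (Icc β₁ β₂) (fun t => Real.log ‖T t‖))
    {ψ₁ ψ₂ : H} (hψ₁ : ‖ψ₁‖ = 1) (hψ₂ : ‖ψ₂‖ = 1)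
    (htop₁ : ⟪ψ₁, T β₁ ψ₁⟫ = ‖T β₁‖) (htop₂ : ⟪ψ₂, T β₂ ψ₂⟫ = ‖T β₂‖)
    (hpos₁ : 0 < ‖T β₁‖) (hpos₂ : 0 < ‖T β₂‖)
    {g₁' g₂' : ℝ} (hg₁ : HasDerivAt (fun t => ⟪ψ₁, T t ψ₁⟫) g₁' β₁)
    (hg₂ : HasDerivAt (fun t => ⟪ψ₂, T t ψ₂⟫) g₂' β₂) :
    g₁' / ‖T β₁‖ ≤ (Real.log ‖T β₂‖ - Real.log ‖T β₁‖) / (β₂ - β₁) ∧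
      (Real.log ‖T β₂‖ - Real.log ‖T β₁‖) / (β₂ - β₁) ≤ g₂' / ‖T β₂‖ := by
  -- touching functions `log ⟪ψᵢ, T t ψᵢ⟫` at `βᵢ`
  have touch : ∀ {β : ℝ} {ψ : H} {g' : ℝ}, ‖ψ‖ = 1 → ⟪ψ, T β ψ⟫ = ‖T β‖ → 0 < ‖T β‖ →
      HasDerivAt (fun t => ⟪ψ, T t ψ⟫) g' β →
      (∀ᶠ t in 𝓝 β, Real.log ⟪ψ, T t ψ⟫ ≤ Real.log ‖T t‖) ∧
        Real.log ⟪ψ, T β ψ⟫ = Real.log ‖T β‖ ∧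
        HasDerivAt (fun t => Real.log ⟪ψ, T t ψ⟫) (g' / ‖T β‖) β := by
    intro β ψ g' hψ htop hpos hg
    have hposβ : 0 < ⟪ψ, T β ψ⟫ := by rw [htop]; exact hpos
    have hev : ∀ᶠ t in 𝓝 β, 0 < ⟪ψ, T t ψ⟫ := hg.continuousAt.eventually (lt_mem_nhds hposβ)
    refine ⟨?_, by rw [htop], ?_⟩
    · filter_upwards [hev] with t ht
      refine Real.log_le_log ht ?_
      calc ⟪ψ, T t ψ⟫ ≤ ‖ψ‖ * ‖T t ψ‖ := real_inner_le_norm _ _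
        _ ≤ ‖ψ‖ * (‖T t‖ * ‖ψ‖) := by gcongr; exact (T t).le_opNorm ψ
        _ = ‖T t‖ := by rw [hψ, one_mul, mul_one]
    · have h := hg.log hposβ.ne'
      rwa [htop] at h
  obtain ⟨hle₁, heq₁, hd₁⟩ := touch hψ₁ htop₁ hpos₁ hg₁
  obtain ⟨hle₂, heq₂, hd₂⟩ := touch hψ₂ htop₂ hpos₂ hg₂
  exact hasDerivAt_le_slope_le_hasDerivAt hβ hconv hle₁ heq₁ hd₁ hle₂ heq₂ hd₂

end Monotone

end Literature.Analysis.OperatorTheory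

end
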